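import Summits.CriticalPhenomena.PercolationContinuityZ3.Theorems.PercNearOneGluingNoHeavyQuantGatedSliceMixLawRegimeBTwoMid
import Summits.CriticalPhenomena.PercolationContinuityZ3.Theorems.PercNearOneGluingNoHeavyQuantGatedSliceMixLawKinkRatio
import HarnessLib

/-!
# QUANT lane R8, T-DEC, leg (III), blob case — `MixLawCellBTopBelow` AT THE EXACT KINK, routes R3 and B (`k₁` sent into `W`'s mid):
# `k₁` cheap at the top and over-filling it (R3), or the top filled only with `k₁`'s help (B)

builds on p205010 (kernel theorem, internal audit signed; external expert review pending)

Support file (`--supports stmt-CriticalPhenomena-4575`), QUANT lane census seat (design 2, gen 61), rung R8 of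
`run/shared/lean/prim/quant/LADDER.md`; memo `run/shared/lean/prim/quant/prim-quant-census-2-g61/REGIME-B-TOP-G61.md`.
Theorems only, standard axioms, no sorries, no definitions.

THE CELL `MixLawCellBTopBelow` (`…RegimeBCells`): the weak-mid law `W_h = (1−S/h)δ₀ + (S/h)(1−g)δ_h + (S/h)gδ_{h+a} ∉ D`, the moved law
`P = zδ₀ + m₁δ_{k₁} + m₁'δ_ℓ + m₂δ_{k₂} + m₂'δ_{k₂+a}` (`ℓ = k₁ + a` a `t`-low, `t = S + ag(1−z)`), both `h < k₂` mids of the target, the top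
`k₂` saturated by its lows.  EXACT KINK: the mixture `θ·W_h + (1−θ)·P` fills `W`'s mid with lows of `P` (`θ·(S/h)(1−g) = (1−θ)·D`) and is
feasible on the giants iff `D·e' ≤ (S/h)(1−g)·R` (`e' = u(1−S/h) − (S/h)g` the zero deficit of `W_h`, `R` the giant room of `P` left by
the zeros and the lows sent there at rate `u = y/(1−y)`).  By the kink-ratio lemma `usage_kink_le` (`…KinkRatio`) the left side is at
most `(S/h)(1−g)·[the same lows' demand on k₂]`, and THAT is bounded by the pooled inequality of the pair `(k₁,k₂)` (`pooled_dear` /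
`pooled_cheap`, `…Pooled`) — so the routes below are UNCONDITIONAL except for the input `Φ(k₁)` of the routes sending `k₁` into `h`.

* `LawDec.gatedSliceMixLaw_regimeB_topBelow_R3` — `k₁` cheap at `k₂`, `m₂ ≤ U(k₁,k₂)m₁`: `k₁` fills `k₂`, its remainder and all of `ℓ`
  go into `h`, zeros to the giants; giant inequality ⟸ `pooled_cheap` + `Φ(ℓ)` + `Φ(k₁)` (hypothesis `hΦ₁`).
* `LawDec.gatedSliceMixLaw_regimeB_topBelow_B` — `U(ℓ,k₂)m₁' ≤ m₂ ≤ U(ℓ,k₂)m₁' + U(k₁,k₂)m₁`, `k₁` cheap at `k₂`: `ℓ → k₂`, `k₁` fills the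
  rest, its remainder into `h`, zeros to the giants; giant inequality ⟸ `pooled_cheap` (exactly) + `Φ(k₁)` (hypothesis `hΦ₁`).
`hΦ₁ : (u(h−S) − Sg)·U(k₁,h) ≤ S(1−g)·U(k₁,k₂)` is `usage_kink_le` for `k₁` whenever `k₁` is light at `h` or `k₁ ≥ t − S`
(`…RegimeBTopBelowCell`); the remaining thin sub-case is the cell's residual.

[this work].  The gluing rows served [cite: KozmaNitzan2024, Conjecture 3 (p. 15)]; product measure [cite: Grimmett1999, §1.3 p. 10].
-/

noncomputable section

namespace Summit.CriticalPhenomena.PercolationContinuityZ3.Theorems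

namespace Quant

open Finset

/-- the two-point law `{lo, hi; g}` (as in `…QuantLawDEC`) -/
local notation3 "TP[" lo ", " hi ", " g ", " h "]" =>
  (g : ℝ) * (if (h : ℕ) = (hi : ℕ) then (1 : ℝ) else 0) + (1 - (g : ℝ)) * (if (h : ℕ) = (lo : ℕ) then (1 : ℝ) else 0)

namespace LawDec

set_option maxHeartbeats 1600000 in
/-- **`h < k₂`, `k₁` CHEAP AT THE TOP AND OVER-FILLING IT BY ITSELF** (route R3): `k₁` fills `k₂` (`β' = m₂/U(k₁,k₂)`) and sends
its remainder into `W`'s mid `h`, the shifted low `ℓ` goes into `h` entirely, the zeros to the giants; mixture at the exact kink; the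
giant inequality from `pooled_cheap` and the kink-ratio lemma for BOTH `ℓ` and `k₁` (for `k₁` taken as the hypothesis `hΦ₁`). [this work] -/
theorem gatedSliceMixLaw_regimeB_topBelow_R3 (y z g S lam : ℝ) (a j M h k₁ k₂ : ℕ)
    (hy0 : 0 < y) (hy1 : y < 1) (hz0 : 0 ≤ z) (hz1 : z < 1) (hg1 : g < 1) (hyg : y ≤ (1 - z) * g)
    (hS0 : 0 < S) (hta : y * (M : ℝ) ≤ S) (_hhj : h ≤ j) (hhM : h ≤ M) (hSh : S < (h : ℝ))
    (hk : k₁ ≤ k₂) (hk₂M : k₂ ≤ M) (hlam0 : 0 ≤ lam) (hlam1 : lam ≤ 1)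
    (hmean : (1 - z) * ((k₁ : ℝ) + ((k₂ : ℝ) - k₁) * lam) = S)
    (hk₁j : k₁ ≤ j) (hk1low : 2 * (k₁ : ℝ) < S + (a : ℝ) * g * (1 - z))
    (hllow : 2 * ((k₁ + a : ℕ) : ℝ) < S + (a : ℝ) * g * (1 - z)) (hlj : k₁ + a ≤ j) (hk₂aG : j + 1 ≤ k₂ + a) (hhaG : j + 1 ≤ h + a)
    (hk₂j : k₂ ≤ j) (hk₂mid : S + (a : ℝ) * g * (1 - z) ≤ 2 * (k₂ : ℝ)) (hhk₂ : h < k₂)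
    (hhmid : S + (a : ℝ) * g * (1 - z) ≤ 2 * (h : ℝ)) (hcomp1h : S + (a : ℝ) * g * (1 - z) < (k₁ : ℝ) + h)
    (hcheapk : S + (a : ℝ) * g * (1 - z) - 2 * (k₁ : ℝ) ≤ y * ((k₂ : ℝ) - k₁))
    (hover1 : (1 - z) * lam * (1 - g) ≤ usage y (S + (a : ℝ) * g * (1 - z)) j k₁ k₂ * ((1 - z) * (1 - lam) * (1 - g)))
    (hΦ₁ : (y / (1 - y) * ((h : ℝ) - S) - S * g) * usage y (S + (a : ℝ) * g * (1 - z)) j k₁ h ≤ S * (1 - g) * usage y (S + (a : ℝ) * g * (1 - z)) j k₁ k₂) :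
    ∃ θ : ℝ, 0 ≤ θ ∧ θ < 1 ∧
      DECAtT y (S + (a : ℝ) * g * (1 - z)) j (M + a)
        (fun p => θ * weakMidLaw S g h a p
          + (1 - θ) * (z * (if p = 0 then (1 : ℝ) else 0) + (1 - z) * slice (fun q => TP[k₁, k₂, lam, q]) a g p)) := by
  classical
  set t : ℝ := S + (a : ℝ) * g * (1 - z) with ht
  have h1z : 0 < 1 - z := by linarith
  have hg0 : 0 < g := by nlinarith
  have h1y : 0 < 1 - y := by linarith
  have ha0 : (0 : ℝ) ≤ a := Nat.cast_nonneg a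
  have hk0 : (0 : ℝ) ≤ k₁ := Nat.cast_nonneg k₁
  have hh0 : (0 : ℝ) < h := lt_trans hS0 hSh
  have hhk₂' : (h : ℝ) < k₂ := by exact_mod_cast hhk₂
  have hyh : y * (h : ℝ) ≤ S := le_trans (mul_le_mul_of_nonneg_left (by exact_mod_cast hhM) hy0.le) hta
  have hyk₂ : y * (k₂ : ℝ) ≤ S := le_trans (mul_le_mul_of_nonneg_left (by exact_mod_cast hk₂M) hy0.le) hta
  have hlam0' : 0 ≤ 1 - lam := by linarith
  have hagw0 : 0 ≤ (a : ℝ) * g * (1 - z) := mul_nonneg (mul_nonneg ha0 hg0.le) h1z.le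
  have hagwa : (a : ℝ) * g * (1 - z) ≤ a := by nlinarith [mul_nonneg ha0 hg0.le]
  have ht0 : 0 < t := by rw [ht]; linarith
  set m₁ : ℝ := (1 - z) * (1 - lam) * (1 - g) with hm₁
  set m₁' : ℝ := (1 - z) * (1 - lam) * g with hm₁'
  set m₂ : ℝ := (1 - z) * lam * (1 - g) with hm₂
  set m₂' : ℝ := (1 - z) * lam * g with hm₂'
  have hm₁0 : 0 ≤ m₁ := mul_nonneg (mul_nonneg h1z.le hlam0') (by linarith)
  have hm₁'0 : 0 ≤ m₁' := mul_nonneg (mul_nonneg h1z.le hlam0') hg0.le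
  have hm₂0 : 0 ≤ m₂ := mul_nonneg (mul_nonneg h1z.le hlam0) (by linarith)
  have hm₂'0 : 0 ≤ m₂' := mul_nonneg (mul_nonneg h1z.le hlam0) hg0.le
  have hΛ : (1 - z) * lam = m₂ + m₂' := by rw [hm₂, hm₂']; ring
  have hlam1' : lam < 1 := by
    by_contra hc
    have hl1 : lam = 1 := le_antisymm hlam1 (not_lt.1 hc)
    have e1 : m₁' = 0 := by rw [hm₁', hl1]; ring
    have e1b : m₁ = 0 := by rw [hm₁, hl1]; ring
    have e2 : m₂ = (1 - z) * (1 - g) := by rw [hm₂, hl1]; ring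
    have h3 : m₂ ≤ 0 := by
      have := hover1; rw [e1b, mul_zero] at this; exact this
    rw [e2] at h3
    nlinarith [mul_pos h1z (show (0:ℝ) < 1 - g by linarith)]
  have hSk₂ : S < (k₂ : ℝ) := by
    have hkk : (0 : ℝ) < (k₂ : ℝ) - k₁ := by linarith
    have hk₂pos : (0 : ℝ) ≤ k₂ := Nat.cast_nonneg k₂
    have e : (k₂ : ℝ) - S = z * k₂ + (1 - z) * (1 - lam) * ((k₂ : ℝ) - k₁) := by rw [← hmean]; ring
    have p1 : 0 < (1 - z) * (1 - lam) * ((k₂ : ℝ) - k₁) := mul_pos (mul_pos h1z (by linarith)) hkk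
    have p2 : 0 ≤ z * (k₂ : ℝ) := mul_nonneg hz0 hk₂pos
    linarith only [e, p1, p2]
  set w₀ : ℝ := 1 - S / h with hw₀
  set Wh : ℝ := S / h * (1 - g) with hWh
  set WG : ℝ := S / h * g with hWG
  have hSh' : 0 < S / (h : ℝ) := div_pos hS0 hh0
  have hw0 : 0 ≤ w₀ := by rw [hw₀, sub_nonneg, div_le_one hh0]; exact hSh.le
  have hWhpos : 0 < Wh := mul_pos hSh' (by linarith)
  have hWG0 : 0 ≤ WG := mul_nonneg hSh'.le hg0.le
  have hcompk : t < ((k₁ + a : ℕ) : ℝ) + k₂ := by push_cast; rw [ht]; linarith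
  have hcomph : t < ((k₁ + a : ℕ) : ℝ) + h := by push_cast; rw [ht]; linarith
  have hlk : k₁ + a < k₂ := by
    have : ((k₁ + a : ℕ) : ℝ) < k₂ := by push_cast at hllow hcompk ⊢; linarith
    exact_mod_cast this
  have hlh : k₁ + a < h := by
    have : ((k₁ + a : ℕ) : ℝ) < h := by push_cast at hllow hcomph ⊢; linarith
    exact_mod_cast this
  have hk1h : k₁ < h := by omega
  set Ulk : ℝ := usage y t j (k₁ + a) k₂ with hUlk
  set Ulh : ℝ := usage y t j (k₁ + a) h with hUlh
  set U1h : ℝ := usage y t j k₁ h with hU1h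
  set U1k : ℝ := usage y t j k₁ k₂ with hU1k
  have hUlkpos : 0 < Ulk := usage_pos_of_compat y t j (k₁ + a) k₂ hy0 hy1 hllow hlk (Or.inr hcompk)
  have hUlhpos : 0 < Ulh := usage_pos_of_compat y t j (k₁ + a) h hy0 hy1 hllow hlh (Or.inr hcomph)
  have hU1hpos : 0 < U1h := usage_pos_of_compat y t j k₁ h hy0 hy1 hk1low hk1h (Or.inr hcomp1h)
  have hcomp1k : t < (k₁ : ℝ) + k₂ := by
    have hpos : (0 : ℝ) < (k₂ : ℝ) - k₁ := by linarith
    have : y * ((k₂ : ℝ) - k₁) < 1 * ((k₂ : ℝ) - k₁) := mul_lt_mul_of_pos_right hy1 hpos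
    linarith only [this, hcheapk]
  have hk1k : k₁ < k₂ := by omega
  have hU1kpos : 0 < U1k := usage_pos_of_compat y t j k₁ k₂ hy0 hy1 hk1low hk1k (Or.inr hcomp1k)
  -- the rest of k₂ after the shifted low, taken by k₁; the overflow of k₁ rides W's mid
  set β : ℝ := m₂ / U1k with hβ
  have hβ0 : 0 ≤ β := div_nonneg hm₂0 hU1kpos.le
  have hβU : U1k * β = m₂ := by rw [hβ]; field_simp
  have hβle : β ≤ m₁ := by
    rw [hβ, div_le_iff₀ hU1kpos, mul_comm]; exact hover1
  set D : ℝ := U1h * (m₁ - β) + Ulh * m₁' with hD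
  have hD0 : 0 ≤ D := add_nonneg (mul_nonneg hU1hpos.le (by linarith)) (mul_nonneg hUlhpos.le hm₁'0)
  obtain ⟨θ, hθ⟩ : ∃ q : ℝ, q = D / (D + Wh) := ⟨_, rfl⟩
  have hden : 0 < D + Wh := by linarith
  have hθ0 : 0 ≤ θ := by rw [hθ]; exact div_nonneg hD0 hden.le
  have hθ1 : θ < 1 := by rw [hθ, div_lt_one hden]; linarith
  have h1θ : 0 < 1 - θ := by linarith
  have hkink : θ * Wh = (1 - θ) * D := by rw [hθ]; field_simp; ring
  -- the giant inequality at the exact kink: θ·e' ≤ (1−θ)·(m₂' − u z), from Φ(k₁), Φ(ℓ) and the pooled inequality of (k₁, k₂)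
  have hPhi1 : (y / (1 - y) * ((h : ℝ) - S) - S * g) * U1h ≤ S * (1 - g) * U1k := hΦ₁
  have hPhil : (y / (1 - y) * ((h : ℝ) - S) - S * g) * Ulh ≤ S * (1 - g) * Ulk := by
    rw [hUlh, hUlk]
    refine usage_kink_le y S g t j (k₁ + a) h k₂ hy0 hy1 hS0.le hg0.le hllow hcomph hhk₂ hk₂j hyk₂ (Or.inl ?_)
    push_cast; rw [ht]; linarith [hagwa]
  have hpool := pooled_cheap y z g S lam j k₂ a k₁ hy0 hy1 hz0 hz1.le hg0.le hg1.le hlam1 hk₂j hSk₂ hyk₂ hmean hllow hk₂mid hcheapk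
  rw [← hUlk, ← hU1k, ← hm₁', ← hm₁, hΛ] at hpool
  have hE : (y / (1 - y) * w₀ - WG) * D ≤ Wh * (m₂' - y / (1 - y) * z) := by
    have hhne : (h : ℝ) ≠ 0 := hh0.ne'
    have h1yne : (1 - y) ≠ 0 := h1y.ne'
    have h1 : (y / (1 - y) * w₀ - WG) * U1h ≤ Wh * U1k := by
      have e1 : (y / (1 - y) * w₀ - WG) * U1h = ((y / (1 - y) * ((h : ℝ) - S) - S * g) * U1h) / h := by
        rw [hw₀, hWG]; field_simp
      have e2 : Wh * U1k = (S * (1 - g) * U1k) / h := by rw [hWh]; field_simp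
      rw [e1, e2]
      exact div_le_div_of_nonneg_right hPhi1 hh0.le
    have h1' : (y / (1 - y) * w₀ - WG) * Ulh ≤ Wh * Ulk := by
      have e1 : (y / (1 - y) * w₀ - WG) * Ulh = ((y / (1 - y) * ((h : ℝ) - S) - S * g) * Ulh) / h := by
        rw [hw₀, hWG]; field_simp
      have e2 : Wh * Ulk = (S * (1 - g) * Ulk) / h := by rw [hWh]; field_simp
      rw [e1, e2]
      exact div_le_div_of_nonneg_right hPhil hh0.le
    have h2 : (y / (1 - y) * w₀ - WG) * D
        = (y / (1 - y) * w₀ - WG) * U1h * (m₁ - β) + (y / (1 - y) * w₀ - WG) * Ulh * m₁' := by rw [hD]; ring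
    have h3 := mul_le_mul_of_nonneg_right h1 (by linarith [hβle] : (0 : ℝ) ≤ m₁ - β)
    have h3' := mul_le_mul_of_nonneg_right h1' hm₁'0
    have h4 : U1k * (m₁ - β) = U1k * m₁ - m₂ := by rw [mul_sub, hβU]
    have h5 : Wh * U1k * (m₁ - β) + Wh * Ulk * m₁' ≤ Wh * (m₂' - y / (1 - y) * z) := by
      have e : Wh * U1k * (m₁ - β) + Wh * Ulk * m₁' = Wh * (U1k * (m₁ - β) + Ulk * m₁') := by ring
      rw [e]; exact mul_le_mul_of_nonneg_left (by rw [h4]; linarith [hpool]) hWhpos.le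
    linarith [h2, h3, h3', h5]
  have hG : y / (1 - y) * ((θ * w₀ + (1 - θ) * z) + 0) ≤ θ * WG + (1 - θ) * m₂' := by
    have h1 : Wh * (θ * (y / (1 - y) * w₀ - WG)) = (1 - θ) * ((y / (1 - y) * w₀ - WG) * D) := by
      linear_combination (y / (1 - y) * w₀ - WG) * hkink
    have h2 := mul_le_mul_of_nonneg_left hE h1θ.le
    have h3 : Wh * (θ * (y / (1 - y) * w₀ - WG)) ≤ Wh * ((1 - θ) * (m₂' - y / (1 - y) * z)) := by
      rw [h1]; linarith [h2]
    have h4 := le_of_mul_le_mul_left h3 hWhpos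
    linarith [h4]
  have Pk1 := flowAtT_pair y t j (M + a) k₁ k₂ ((1 - θ) * β) ((1 - θ) * m₂) hk₁j hk1low (by omega) (Or.inr hk₂mid)
    (Or.inr hcomp1k) (mul_nonneg h1θ.le hβ0) (le_of_eq (by rw [← hU1k, ← hβU]; ring))
  have P1 := flowAtT_pair y t j (M + a) k₁ h ((1 - θ) * (m₁ - β)) (U1h * ((1 - θ) * (m₁ - β))) hk₁j hk1low (by omega)
    (Or.inr hhmid) (Or.inr hcomp1h) (mul_nonneg h1θ.le (by linarith)) (by rw [← hU1h])
  have Pl := flowAtT_pair y t j (M + a) (k₁ + a) h ((1 - θ) * m₁') (θ * Wh - U1h * ((1 - θ) * (m₁ - β))) hlj hllow (by omega)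
    (Or.inr hhmid) (Or.inr hcomph) (mul_nonneg h1θ.le hm₁'0) (le_of_eq (by rw [← hUlh, hkink, hD]; ring))
  have Pg := flowAtT_lows_giants₂ y t j (M + a) k₁ (h + a) (k₂ + a) (θ * w₀ + (1 - θ) * z) 0 (θ * WG) ((1 - θ) * m₂')
    hy0 hy1 (add_nonneg (mul_nonneg hθ0 hw0) (mul_nonneg h1θ.le hz0)) le_rfl (mul_nonneg hθ0 hWG0)
    (mul_nonneg h1θ.le hm₂'0) hk₁j hk1low hhaG (by omega) hk₂aG (by omega) (by linarith [hG])
  -- assemble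
  have hsum := FlowAtT.add (FlowAtT.add (FlowAtT.add Pk1 P1) Pl) Pg
  have hflow : FlowAtT y t j (M + a) (fun p => θ * weakMidLaw S g h a p
      + (1 - θ) * (z * (if p = 0 then (1 : ℝ) else 0) + (1 - z) * slice (fun q => TP[k₁, k₂, lam, q]) a g p)) := by
    refine (congrArg (FlowAtT y t j (M + a)) (funext fun p => ?_)).mp hsum
    rw [movedTwoPoint_apply, ← hm₁, ← hm₁', ← hm₂, ← hm₂']
    unfold weakMidLaw
    rw [← hw₀, ← hWh, ← hWG]
    have eβ : (1 - θ) * m₁ = (1 - θ) * β + (1 - θ) * (m₁ - β) := by ring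
    linear_combination (-(if p = k₁ then (1 : ℝ) else 0)) * eβ
  exact gatedSliceMixLaw_conclusion_of_flowAtT y z g S lam θ a j M h k₁ k₂ hy0 hy1 hhM hk hk₂M hθ0 hθ1 hflow

set_option maxHeartbeats 1600000 in
/-- **`h < k₂`, TOP OVER-FILLED ONLY WITH `k₁`'S HELP (case B of `MixLawCellBTopBelow`)**: `ℓ → k₂`, `k₁` (cheap at `k₂`) fills the
rest of `k₂` and sends its remainder `m₁ − β` into `W`'s mid `h` (`k₁` compatible with `h`), the zeros to the giants; mixture at the exact
kink.  The giant inequality `e'·U(k₁,h)(m₁ − β) ≤ W_h(h)·(m₂' − u z)` follows from `pooled_cheap` of `(k₁,k₂)` (exactly: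
`U(k₁,k₂)(m₁−β) + u z ≤ m₂'`) and the kink-ratio lemma for `k₁` — taken as the hypothesis `hΦ₁`
(`usage_kink_le` discharges it unless `k₁` is heavy at `h` with `k₁ < t − S`), the one residual input. [this work] -/
theorem gatedSliceMixLaw_regimeB_topBelow_B (y z g S lam : ℝ) (a j M h k₁ k₂ : ℕ)
    (hy0 : 0 < y) (hy1 : y < 1) (hz0 : 0 ≤ z) (hz1 : z < 1) (hg1 : g < 1) (hyg : y ≤ (1 - z) * g)
    (hS0 : 0 < S) (hta : y * (M : ℝ) ≤ S) (_hhj : h ≤ j) (hhM : h ≤ M) (hSh : S < (h : ℝ))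
    (hk : k₁ ≤ k₂) (hk₂M : k₂ ≤ M) (hlam0 : 0 ≤ lam) (hlam1 : lam ≤ 1)
    (hmean : (1 - z) * ((k₁ : ℝ) + ((k₂ : ℝ) - k₁) * lam) = S)
    (hk₁j : k₁ ≤ j) (hk1low : 2 * (k₁ : ℝ) < S + (a : ℝ) * g * (1 - z))
    (hllow : 2 * ((k₁ + a : ℕ) : ℝ) < S + (a : ℝ) * g * (1 - z)) (hlj : k₁ + a ≤ j) (hk₂aG : j + 1 ≤ k₂ + a) (hhaG : j + 1 ≤ h + a)
    (hk₂j : k₂ ≤ j) (hk₂mid : S + (a : ℝ) * g * (1 - z) ≤ 2 * (k₂ : ℝ)) (hhk₂ : h < k₂)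
    (hhmid : S + (a : ℝ) * g * (1 - z) ≤ 2 * (h : ℝ)) (hcomp1h : S + (a : ℝ) * g * (1 - z) < (k₁ : ℝ) + h)
    (hcheapk : S + (a : ℝ) * g * (1 - z) - 2 * (k₁ : ℝ) ≤ y * ((k₂ : ℝ) - k₁))
    (hunsat : usage y (S + (a : ℝ) * g * (1 - z)) j (k₁ + a) k₂ * ((1 - z) * (1 - lam) * g) ≤ (1 - z) * lam * (1 - g))
    (hsat : (1 - z) * lam * (1 - g) ≤ usage y (S + (a : ℝ) * g * (1 - z)) j (k₁ + a) k₂ * ((1 - z) * (1 - lam) * g)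
      + usage y (S + (a : ℝ) * g * (1 - z)) j k₁ k₂ * ((1 - z) * (1 - lam) * (1 - g)))
    (hΦ₁ : (y / (1 - y) * ((h : ℝ) - S) - S * g) * usage y (S + (a : ℝ) * g * (1 - z)) j k₁ h ≤ S * (1 - g) * usage y (S + (a : ℝ) * g * (1 - z)) j k₁ k₂) :
    ∃ θ : ℝ, 0 ≤ θ ∧ θ < 1 ∧
      DECAtT y (S + (a : ℝ) * g * (1 - z)) j (M + a)
        (fun p => θ * weakMidLaw S g h a p
          + (1 - θ) * (z * (if p = 0 then (1 : ℝ) else 0) + (1 - z) * slice (fun q => TP[k₁, k₂, lam, q]) a g p)) := by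
  classical
  set t : ℝ := S + (a : ℝ) * g * (1 - z) with ht
  have h1z : 0 < 1 - z := by linarith
  have hg0 : 0 < g := by nlinarith
  have h1y : 0 < 1 - y := by linarith
  have ha0 : (0 : ℝ) ≤ a := Nat.cast_nonneg a
  have hk0 : (0 : ℝ) ≤ k₁ := Nat.cast_nonneg k₁
  have hh0 : (0 : ℝ) < h := lt_trans hS0 hSh
  have hhk₂' : (h : ℝ) < k₂ := by exact_mod_cast hhk₂
  have hyh : y * (h : ℝ) ≤ S := le_trans (mul_le_mul_of_nonneg_left (by exact_mod_cast hhM) hy0.le) hta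
  have hyk₂ : y * (k₂ : ℝ) ≤ S := le_trans (mul_le_mul_of_nonneg_left (by exact_mod_cast hk₂M) hy0.le) hta
  have hlam0' : 0 ≤ 1 - lam := by linarith
  have hagw0 : 0 ≤ (a : ℝ) * g * (1 - z) := mul_nonneg (mul_nonneg ha0 hg0.le) h1z.le
  have hagwa : (a : ℝ) * g * (1 - z) ≤ a := by nlinarith [mul_nonneg ha0 hg0.le]
  have ht0 : 0 < t := by rw [ht]; linarith
  set m₁ : ℝ := (1 - z) * (1 - lam) * (1 - g) with hm₁
  set m₁' : ℝ := (1 - z) * (1 - lam) * g with hm₁'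
  set m₂ : ℝ := (1 - z) * lam * (1 - g) with hm₂
  set m₂' : ℝ := (1 - z) * lam * g with hm₂'
  have hm₁0 : 0 ≤ m₁ := mul_nonneg (mul_nonneg h1z.le hlam0') (by linarith)
  have hm₁'0 : 0 ≤ m₁' := mul_nonneg (mul_nonneg h1z.le hlam0') hg0.le
  have hm₂0 : 0 ≤ m₂ := mul_nonneg (mul_nonneg h1z.le hlam0) (by linarith)
  have hm₂'0 : 0 ≤ m₂' := mul_nonneg (mul_nonneg h1z.le hlam0) hg0.le
  have hΛ : (1 - z) * lam = m₂ + m₂' := by rw [hm₂, hm₂']; ring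
  have hlam1' : lam < 1 := by
    by_contra hc
    have hl1 : lam = 1 := le_antisymm hlam1 (not_lt.1 hc)
    have e1 : m₁' = 0 := by rw [hm₁', hl1]; ring
    have e1b : m₁ = 0 := by rw [hm₁, hl1]; ring
    have e2 : m₂ = (1 - z) * (1 - g) := by rw [hm₂, hl1]; ring
    have h3 : m₂ ≤ 0 := by rw [e1, e1b, mul_zero, mul_zero, add_zero] at hsat; exact hsat
    rw [e2] at h3
    nlinarith [mul_pos h1z (show (0:ℝ) < 1 - g by linarith)]
  have hSk₂ : S < (k₂ : ℝ) := by
    have hkk : (0 : ℝ) < (k₂ : ℝ) - k₁ := by linarith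
    have hk₂pos : (0 : ℝ) ≤ k₂ := Nat.cast_nonneg k₂
    have e : (k₂ : ℝ) - S = z * k₂ + (1 - z) * (1 - lam) * ((k₂ : ℝ) - k₁) := by rw [← hmean]; ring
    have p1 : 0 < (1 - z) * (1 - lam) * ((k₂ : ℝ) - k₁) := mul_pos (mul_pos h1z (by linarith)) hkk
    have p2 : 0 ≤ z * (k₂ : ℝ) := mul_nonneg hz0 hk₂pos
    linarith only [e, p1, p2]
  set w₀ : ℝ := 1 - S / h with hw₀
  set Wh : ℝ := S / h * (1 - g) with hWh
  set WG : ℝ := S / h * g with hWG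
  have hSh' : 0 < S / (h : ℝ) := div_pos hS0 hh0
  have hw0 : 0 ≤ w₀ := by rw [hw₀, sub_nonneg, div_le_one hh0]; exact hSh.le
  have hWhpos : 0 < Wh := mul_pos hSh' (by linarith)
  have hWG0 : 0 ≤ WG := mul_nonneg hSh'.le hg0.le
  have hcompk : t < ((k₁ + a : ℕ) : ℝ) + k₂ := by push_cast; rw [ht]; linarith
  have hcomph : t < ((k₁ + a : ℕ) : ℝ) + h := by push_cast; rw [ht]; linarith
  have hlk : k₁ + a < k₂ := by
    have : ((k₁ + a : ℕ) : ℝ) < k₂ := by push_cast at hllow hcompk ⊢; linarith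
    exact_mod_cast this
  have hlh : k₁ + a < h := by
    have : ((k₁ + a : ℕ) : ℝ) < h := by push_cast at hllow hcomph ⊢; linarith
    exact_mod_cast this
  have hk1h : k₁ < h := by omega
  set Ulk : ℝ := usage y t j (k₁ + a) k₂ with hUlk
  set Ulh : ℝ := usage y t j (k₁ + a) h with hUlh
  set U1h : ℝ := usage y t j k₁ h with hU1h
  set U1k : ℝ := usage y t j k₁ k₂ with hU1k
  have hUlkpos : 0 < Ulk := usage_pos_of_compat y t j (k₁ + a) k₂ hy0 hy1 hllow hlk (Or.inr hcompk)
  have hUlhpos : 0 < Ulh := usage_pos_of_compat y t j (k₁ + a) h hy0 hy1 hllow hlh (Or.inr hcomph)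
  have hU1hpos : 0 < U1h := usage_pos_of_compat y t j k₁ h hy0 hy1 hk1low hk1h (Or.inr hcomp1h)
  have hcomp1k : t < (k₁ : ℝ) + k₂ := by
    have hpos : (0 : ℝ) < (k₂ : ℝ) - k₁ := by linarith
    have : y * ((k₂ : ℝ) - k₁) < 1 * ((k₂ : ℝ) - k₁) := mul_lt_mul_of_pos_right hy1 hpos
    linarith only [this, hcheapk]
  have hk1k : k₁ < k₂ := by omega
  have hU1kpos : 0 < U1k := usage_pos_of_compat y t j k₁ k₂ hy0 hy1 hk1low hk1k (Or.inr hcomp1k)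
  -- the rest of k₂ after the shifted low, taken by k₁; the overflow of k₁ rides W's mid
  set L₀ : ℝ := m₂ - Ulk * m₁' with hL₀
  have hL₀0 : 0 ≤ L₀ := by rw [hL₀]; linarith [hunsat]
  set β : ℝ := L₀ / U1k with hβ
  have hβ0 : 0 ≤ β := div_nonneg hL₀0 hU1kpos.le
  have hβU : U1k * β = L₀ := by rw [hβ]; field_simp
  have hβle : β ≤ m₁ := by
    rw [hβ, div_le_iff₀ hU1kpos, hL₀]
    linarith [hsat]
  set D : ℝ := U1h * (m₁ - β) with hD
  have hD0 : 0 ≤ D := mul_nonneg hU1hpos.le (by linarith)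
  obtain ⟨θ, hθ⟩ : ∃ q : ℝ, q = D / (D + Wh) := ⟨_, rfl⟩
  have hden : 0 < D + Wh := by linarith
  have hθ0 : 0 ≤ θ := by rw [hθ]; exact div_nonneg hD0 hden.le
  have hθ1 : θ < 1 := by rw [hθ, div_lt_one hden]; linarith
  have h1θ : 0 < 1 - θ := by linarith
  have hkink : θ * Wh = (1 - θ) * D := by rw [hθ]; field_simp; ring
  -- the giant inequality at the exact kink: θ·e' ≤ (1−θ)·(m₂' − u z), from Φ(k₁) and the pooled inequality of (k₁, k₂)
  have hPhi : (y / (1 - y) * ((h : ℝ) - S) - S * g) * U1h ≤ S * (1 - g) * U1k := hΦ₁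
  have hpool := pooled_cheap y z g S lam j k₂ a k₁ hy0 hy1 hz0 hz1.le hg0.le hg1.le hlam1 hk₂j hSk₂ hyk₂ hmean hllow hk₂mid hcheapk
  rw [← hUlk, ← hU1k, ← hm₁', ← hm₁, hΛ] at hpool
  have hE : (y / (1 - y) * w₀ - WG) * D ≤ Wh * (m₂' - y / (1 - y) * z) := by
    have h1 : (y / (1 - y) * w₀ - WG) * U1h ≤ Wh * U1k := by
      have hhne : (h : ℝ) ≠ 0 := hh0.ne'
      have h1yne : (1 - y) ≠ 0 := h1y.ne'
      have e1 : (y / (1 - y) * w₀ - WG) * U1h = ((y / (1 - y) * ((h : ℝ) - S) - S * g) * U1h) / h := by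
        rw [hw₀, hWG]; field_simp
      have e2 : Wh * U1k = (S * (1 - g) * U1k) / h := by rw [hWh]; field_simp
      rw [e1, e2]
      exact div_le_div_of_nonneg_right hPhi hh0.le
    have h2 : (y / (1 - y) * w₀ - WG) * D = (y / (1 - y) * w₀ - WG) * U1h * (m₁ - β) := by rw [hD]; ring
    have h3 := mul_le_mul_of_nonneg_right h1 (by linarith [hβle] : (0 : ℝ) ≤ m₁ - β)
    have h4 : U1k * (m₁ - β) = U1k * m₁ - L₀ := by rw [mul_sub, hβU]
    have h5 : Wh * U1k * (m₁ - β) ≤ Wh * (m₂' - y / (1 - y) * z) := by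
      rw [mul_assoc, h4, hL₀]; exact mul_le_mul_of_nonneg_left (by linarith [hpool]) hWhpos.le
    linarith [h2, h3, h5]
  have hG : y / (1 - y) * ((θ * w₀ + (1 - θ) * z) + 0) ≤ θ * WG + (1 - θ) * m₂' := by
    have h1 : Wh * (θ * (y / (1 - y) * w₀ - WG)) = (1 - θ) * ((y / (1 - y) * w₀ - WG) * D) := by
      linear_combination (y / (1 - y) * w₀ - WG) * hkink
    have h2 := mul_le_mul_of_nonneg_left hE h1θ.le
    have h3 : Wh * (θ * (y / (1 - y) * w₀ - WG)) ≤ Wh * ((1 - θ) * (m₂' - y / (1 - y) * z)) := by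
      rw [h1]; linarith [h2]
    have h4 := le_of_mul_le_mul_left h3 hWhpos
    linarith [h4]
  have Pk := flowAtT_pair y t j (M + a) (k₁ + a) k₂ ((1 - θ) * m₁') (Ulk * ((1 - θ) * m₁')) hlj hllow (by omega) (Or.inr hk₂mid)
    (Or.inr hcompk) (mul_nonneg h1θ.le hm₁'0) (by rw [← hUlk])
  have Pk1 := flowAtT_pair y t j (M + a) k₁ k₂ ((1 - θ) * β) ((1 - θ) * L₀) hk₁j hk1low (by omega) (Or.inr hk₂mid)
    (Or.inr hcomp1k) (mul_nonneg h1θ.le hβ0) (le_of_eq (by rw [← hU1k, ← hβU]; ring))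
  have P1 := flowAtT_pair y t j (M + a) k₁ h ((1 - θ) * (m₁ - β)) (θ * Wh) hk₁j hk1low (by omega) (Or.inr hhmid)
    (Or.inr hcomp1h) (mul_nonneg h1θ.le (by linarith)) (by rw [← hU1h]; nlinarith [hkink])
  have Pg := flowAtT_lows_giants₂ y t j (M + a) k₁ (h + a) (k₂ + a) (θ * w₀ + (1 - θ) * z) 0 (θ * WG) ((1 - θ) * m₂')
    hy0 hy1 (add_nonneg (mul_nonneg hθ0 hw0) (mul_nonneg h1θ.le hz0)) le_rfl (mul_nonneg hθ0 hWG0)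
    (mul_nonneg h1θ.le hm₂'0) hk₁j hk1low hhaG (by omega) hk₂aG (by omega) (by linarith [hG])
  -- assemble
  have hsum := FlowAtT.add (FlowAtT.add (FlowAtT.add Pk Pk1) P1) Pg
  have hflow : FlowAtT y t j (M + a) (fun p => θ * weakMidLaw S g h a p
      + (1 - θ) * (z * (if p = 0 then (1 : ℝ) else 0) + (1 - z) * slice (fun q => TP[k₁, k₂, lam, q]) a g p)) := by
    refine (congrArg (FlowAtT y t j (M + a)) (funext fun p => ?_)).mp hsum
    rw [movedTwoPoint_apply, ← hm₁, ← hm₁', ← hm₂, ← hm₂']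
    unfold weakMidLaw
    rw [← hw₀, ← hWh, ← hWG]
    have eL : (1 - θ) * m₂ = Ulk * ((1 - θ) * m₁') + (1 - θ) * L₀ := by rw [hL₀]; ring
    have eβ : (1 - θ) * m₁ = (1 - θ) * β + (1 - θ) * (m₁ - β) := by ring
    linear_combination (-(if p = k₂ then (1 : ℝ) else 0)) * eL - (if p = k₁ then (1 : ℝ) else 0) * eβ
  exact gatedSliceMixLaw_conclusion_of_flowAtT y z g S lam θ a j M h k₁ k₂ hy0 hy1 hhM hk hk₂M hθ0 hθ1 hflow

end LawDec

end Quant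

end Summit.CriticalPhenomena.PercolationContinuityZ3.Theorems
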